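import Mathlib.Algebra.Ring.Basic

/-!
# Venture HSemireg — fibre test: the ATTAINED-RANK criterion for end type R (any amplitude)

HONEST FRAMING. Kernel leaf for the computation cell `pub-hsemireg`, (W³) lane (target seat t-5 gen
29; record `run/shared/lean/pub/pub-hsemireg/target-g6/RR3-t5g29.md`). It is an elementary blockwise
ring identity; nothing in this file constructs an object on an abelian variety, proves the
fibre-test conjecture (W³)₄ or th-3´s END LAW′, or bears on HC, HC_CM or HC_AV.

THE MODEL (cell record W3-PATHALG-t5g13 §1, TH3-UNIVERSAL §0). A reduced-point configuration is a
level-graded space `M = ⊕ M_p` with a pencil `u_a : M_p → M_{p+1}` (`a : Fin 3`) and, for each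
class, potentials `V_b : M_p → M_{p-1}` subject to the Killing relations (E1)
`{u_a, V_b} + {u_b, V_a} = 0`, `{u_a, V_a} = 0`, blockwise at every level. On the bottom level `M_0`
the relation (E1) reads, in the cell´s path order (first block applied first),
`u_a@0 * V_b@1 + u_b@0 * V_a@1 = 0` and `u_a@0 * V_a@1 = 0`; the BOTTOM HOLONOMY of the class is the
family of loops `u_a@0 * V_b@1` (`a ≠ b`), i.e. the restriction to `M_0` of its rotation
`r = rot V`; th-3´s END TYPE R at the bottom (index rank `IR_0 = 0`, relation family R0 of the
cell´s certificates) is `u_a@0 * V_b@1 = 0` for all `a, b`.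

THIS FILE (t-5 g29, LEMMA W of RR3-t5g29.md). If the bottom pencil block ATTAINS ITS JOINT IMAGE RANK
in some direction — after a `GL₃` frame change outside this statement: the blocks `u_1@0`, `u_2@0`
factor through `u_0@0`, `u_a@0 = g_a * u_0@0` (path order: first an endomorphism `g_a` of `M_0`,
then `u_0@0`; equivalently `Im u_a|M_0 ⊆ Im u_0|M_0`) — then EVERY Killing class has bottom end
type R: all loops `u_a@0 * V_b@1` vanish. Dually (`top_loops_eq_zero_of_attained_kernel`): if the
top pencil block attains its joint kernel in some direction (`u_a@(L-2) = u_0@(L-2) * h_a`, i.e.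
`ker u_0 ⊆ ker u_a` on `M_{L-2}`), every Killing class has top end type R. Only (E1) at the end
level is used (no closedness (E2), no simplicity, no curvature). CONTENT OF RECORD (RR3-t5g29.md
§2–§4): every exact simple curved THREE-level configuration known to the cell — th-3 g38´s 90
structured∕zoo3 factors, the 2 517 simple curved configurations of t-5 g29´s independent stratified
generator (kit j252300, 1.28 M samples) and the new cross-product family `X(b)` (curvature rank 2,
no rank-one waist) — attains its image rank at the bottom and its kernel at the top, so its end
types (R,R) follow from this file; whether «simple + curved + three levels ⟹ attained» (conjecture
(ATTAIN)₃ there) holds is OPEN. The statements hold in any ring `R` (read: `End(⊕ M_p)` with the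
blocks as elements; absent blocks are zero).
-/

namespace Summit.Ventures.HSemireg.AttainedRankEndCriterion

/-- LEMMA W (bottom). Blocks `u a` (`= u_a@0 : M_0 → M_1`) and `V b` (`= V_b@1 : M_1 → M_0`) of a
Killing class in path order; (E1) on `M_0`: `hdiag : u 0 * V 0 = 0` and the polarised relations
`hpol`; attained image rank in direction `0`: `u a = g a * u 0`. Then every bottom loop
`u a * V b` vanishes (end type R at the bottom, `IR_0 = 0`). -/
theorem bottom_loops_eq_zero_of_attained_image {R : Type*} [Ring R] (u V g : Fin 3 → R)
    (hdiag : u 0 * V 0 = 0) (hpol : ∀ a b, u a * V b + u b * V a = 0)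
    (hatt : ∀ a, u a = g a * u 0) (a b : Fin 3) : u a * V b = 0 := by
  -- step 1: every `u a` kills after `V 0`:  u a * V 0 = g a * (u 0 * V 0) = 0
  have h1 : ∀ c, u c * V 0 = 0 := by
    intro c
    rw [hatt c, mul_assoc, hdiag, mul_zero]
  -- step 2: `u 0 * V c = -(u c * V 0) = 0`
  have h2 : ∀ c, u 0 * V c = 0 := by
    intro c
    have := hpol 0 c
    rw [h1 c, add_zero] at this
    exact this
  -- step 3: `u a * V b = g a * (u 0 * V b) = 0`
  rw [hatt a, mul_assoc, h2 b, mul_zero]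

/-- LEMMA W (top, dual). Blocks `u a` (`= u_a@(L-2) : M_{L-2} → M_{L-1}`) and `V b`
(`= V_b@(L-1) : M_{L-1} → M_{L-2}`) in path order; (E1) on the top level `M_{L-1}` reads
`V b * u a + V a * u b = 0`, `V 0 * u 0 = 0`; attained kernel in direction `0`:
`u a = u 0 * h a` (path order: first `u 0`, then an endomorphism `h a` of `M_{L-1}`; equivalently
`ker u_0 ⊆ ker u_a` on `M_{L-2}`). Then every top loop `V b * u a` vanishes (end type R at the top). -/
theorem top_loops_eq_zero_of_attained_kernel {R : Type*} [Ring R] (u V h : Fin 3 → R)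
    (hdiag : V 0 * u 0 = 0) (hpol : ∀ a b, V b * u a + V a * u b = 0)
    (hatt : ∀ a, u a = u 0 * h a) (a b : Fin 3) : V b * u a = 0 := by
  have h1 : ∀ c, V 0 * u c = 0 := by
    intro c
    rw [hatt c, ← mul_assoc, hdiag, zero_mul]
  have h2 : ∀ c, V c * u 0 = 0 := by
    intro c
    have := hpol 0 c
    rw [h1 c, add_zero] at this
    exact this
  rw [hatt a, ← mul_assoc, h2 b, zero_mul]

/-- COROLLARY (the form used in the census): under the hypotheses of LEMMA W (bottom) the cubic
operator `T = Σ_σ sgn σ · B_{σ0} B′_{σ1} B″_{σ2}` of ANY three Killing classes vanishes on `M_0`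
term by term, because each of its words starts with a bottom loop `u a * V b` of the first class;
here recorded for one word: a product `u a * V b * x` with an arbitrary continuation `x` is zero. -/
theorem bottom_word_eq_zero_of_attained_image {R : Type*} [Ring R] (u V g : Fin 3 → R)
    (hdiag : u 0 * V 0 = 0) (hpol : ∀ a b, u a * V b + u b * V a = 0)
    (hatt : ∀ a, u a = g a * u 0) (a b : Fin 3) (x : R) : u a * V b * x = 0 := by
  rw [bottom_loops_eq_zero_of_attained_image u V g hdiag hpol hatt a b, zero_mul]

end Summit.Ventures.HSemireg.AttainedRankEndCriterion
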